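import Literature.AnabelianGeometry.SemiGraphs.TemperedCompactPairUnfoldedInfiniteValence
import Literature.AnabelianGeometry.SemiGraphs.TemperedVerticialMaximalCompactOfElevation
import HarnessLib

/-!
# The three open ∀-pieces of [SemiAnbd] Thm 3.7 (iv) in the cell's countable typing — the ANCHORED PACKAGE, the
# ISOLATION of exotic maximal compact subgroups, and SENTENCE 2 — all reduce to ONE residual: persistent unfolded
# fixed branch pairs over a base vertex of INFINITE valence

Mochizuki, *Semi-graphs of anabelioids*, Publ. RIMS **42** (2006), §3, Theorem 3.7 (iv) p. 41: "The maximal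
compact subgroups of `π₁^temp(𝒢)` are precisely the verticial subgroups. The nontrivial intersections of two distinct
maximal compact subgroups of `π₁^temp(𝒢)` are precisely the edge-like subgroups." [cite: MochizukiSemiAnbd2006, Thm 3.7(iv) p.41].

PROOF-ONLY tool file (abc-iut cell, layer L3, row «T37iv-S2@RELATIVE-BRIDGE», file F5, seat abc-iut-L3-t8 gen 10;
no definition, no named fact).  Corollaries of the trichotomy (F1–F4 of this row) and of abc-iut-w6-d064's
«verticial ⇒ maximal compact» (`eq_of_verticial_le_compact`, every countable Thm-3.7 graph).  Canonical chart
of ANY countable `𝒢` satisfying the hypotheses of Thm 3.7; call a compact subgroup *exotic* if it lies in no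
verticial subgroup.  In each statement the second alternative is the residual of F4: a level `m`, a vertex `z`
of `𝒢_{∞,m}` fixed by neither subgroup and lying over a base vertex of INFINITE valence, over which every deeper
level carries an unfolded branch pair fixed by the whole intersection.

* ★ `residual_of_exotic_inf_verticial_ne_bot` — ANCHORED PACKAGE: an exotic compact subgroup meeting a
  verticial subgroup non-trivially forces the residual (so at infinite valence only);
* ★ `le_or_residual_of_isMaximalCompactSubgroup_of_exotic` — ISOLATION: a compact subgroup meeting an exotic
  maximal compact subgroup non-trivially lies in it, or the residual holds;
* ★ `verticial_or_residual_of_isMaximalCompactSubgroup_of_ne` — SENTENCE 2: two distinct maximal compact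
  subgroups meeting non-trivially are BOTH VERTICIAL with intersection inside an edge-like subgroup, or the
  residual holds.

Hence all three ∀-pieces hold outright at every vertex of finite valence in the sense that any failure is
witnessed over a base vertex of infinite valence (abc-iut-L3-t8's rayless star `𝒢⋆(p)` being the known
instance where sentence 1 fails).  Honest framing: statements about OUR typed `π₁^temp`; nothing here bears on
[IUTchIII] Cor. 3.12; no side taken; typed ≠ proved elsewhere.
-/
noncomputable section

open CategoryTheory Topology

namespace Literature.AnabelianGeometry.SemiGraphs

open SimpleGraph

universe u

namespace ProfiniteSemiGraph

variable {𝒢 : ProfiniteSemiGraph.{u}}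

/-! ### The anchored package reduces to the residual -/

/-- ★ **ANCHORED PACKAGE, up to the residual.**  Let `H` be verticial and `K` an EXOTIC compact subgroup of
`π₁^temp(𝒢)` (in no verticial subgroup) with `H ⊓ K ≠ 1`.  Then there are a level `m` and a vertex `z` of
`𝒢_{∞,m}`, fixed by neither `H` nor `K`, over a base vertex of INFINITE valence, such that every level `M ≥ m`
carries an unfolded `H ⊓ K`-fixed branch pair over `z`.  (`(H ⊔ K)‾` compact would contain the verticial `H`,
hence equal it — verticial subgroups are maximal compact, abc-iut-w6-d064 — forcing `K ≤ H`; and `K` anchored is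
excluded; so the third regime of the trichotomy applies.) [cite: MochizukiSemiAnbd2006, Thm 3.7(iv) p.41] -/
theorem residual_of_exotic_inf_verticial_ne_bot (h37 : 𝒢.Thm37Hypotheses) {v : 𝒢.graph.Vertex}
    (H K : Subgroup ((𝒢.galoisLevelData h37.toProp36Hypotheses).temperedPi h37.toProp36Hypotheses.isCountable))
    (hH : H ∈ verticialSubgroups (𝒢.temperedPiChart h37.toProp36Hypotheses) v)
    (hK : IsCompact (K : Set ((𝒢.galoisLevelData h37.toProp36Hypotheses).temperedPi
      h37.toProp36Hypotheses.isCountable)))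
    (hKex : ∀ (w : 𝒢.graph.Vertex) (H' : Subgroup (𝒢.temperedPiChart h37.toProp36Hypotheses).G),
      H' ∈ verticialSubgroups (𝒢.temperedPiChart h37.toProp36Hypotheses) w → ¬ K ≤ H')
    (hne : H ⊓ K ≠ ⊥) :
    ∃ (m : ℕ) (z : ((𝒢.galoisLevelData h37.toProp36Hypotheses).tree m).Vertex),
      (¬ ∀ k ∈ H, ((𝒢.galoisLevelData h37.toProp36Hypotheses).treeAct h37.toProp36Hypotheses.isCountable m
          k).hom.vertexMap z = z) ∧
      (¬ ∀ k ∈ K, ((𝒢.galoisLevelData h37.toProp36Hypotheses).treeAct h37.toProp36Hypotheses.isCountable m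
          k).hom.vertexMap z = z) ∧
      ¬ {b : 𝒢.graph.Branch | 𝒢.graph.abuts b =
          some (((𝒢.galoisLevelData h37.toProp36Hypotheses).treeProj m).vertexMap z)}.Finite ∧
      ∀ (M : ℕ) (hmM : m ≤ M),
        ∃ (w : ((𝒢.galoisLevelData h37.toProp36Hypotheses).tree M).Vertex)
          (β β' : ((𝒢.galoisLevelData h37.toProp36Hypotheses).tree M).Branch),
          ((𝒢.galoisLevelData h37.toProp36Hypotheses).tree M).abuts β = some w ∧
          ((𝒢.galoisLevelData h37.toProp36Hypotheses).tree M).abuts β' = some w ∧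
          ((𝒢.galoisLevelData h37.toProp36Hypotheses).treeTrans hmM).vertexMap w = z ∧
          ((𝒢.galoisLevelData h37.toProp36Hypotheses).treeTrans hmM).branchMap β ≠
            ((𝒢.galoisLevelData h37.toProp36Hypotheses).treeTrans hmM).branchMap β' ∧
          ∀ d ∈ H ⊓ K,
            ((𝒢.galoisLevelData h37.toProp36Hypotheses).treeAct h37.toProp36Hypotheses.isCountable M
                d).hom.vertexMap w = w ∧
            ((𝒢.galoisLevelData h37.toProp36Hypotheses).treeAct h37.toProp36Hypotheses.isCountable M
                d).hom.branchMap β = β ∧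
            ((𝒢.galoisLevelData h37.toProp36Hypotheses).treeAct h37.toProp36Hypotheses.isCountable M
                d).hom.branchMap β' = β' := by
  have h36 := h37.toProp36Hypotheses
  have hHc : IsCompact (H : Set ((𝒢.galoisLevelData h36).temperedPi h36.isCountable)) :=
    isCompact_of_mem_verticialSubgroups (𝒢.temperedPiChart h36) hH
  -- `(H ⊔ K)‾` is not compact: it would equal the maximal compact `H`, forcing `K ≤ H`
  have hnot : ¬ IsCompact (((H ⊔ K).topologicalClosure :
      Subgroup ((𝒢.galoisLevelData h36).temperedPi h36.isCountable)) :
        Set ((𝒢.galoisLevelData h36).temperedPi h36.isCountable)) := by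
    intro hcpt
    have hle : H ≤ (H ⊔ K).topologicalClosure := le_sup_left.trans (Subgroup.le_topologicalClosure _)
    have heq := eq_of_verticial_le_compact h37 (𝒢.temperedPiChart h36) hH hcpt hle
    exact hKex v H hH ((le_sup_right.trans (Subgroup.le_topologicalClosure _)).trans heq.le)
  rcases anchored_or_infinite_valence_of_not_isCompact h37 H K hHc hK hne hnot with
    ⟨-, ⟨w, H', hH', hKH'⟩, -⟩ | hres
  · exact absurd hKH' (hKex w H' hH')
  · exact hres

/-! ### Isolation of exotic maximal compact subgroups reduces to the residual -/

/-- ★ **ISOLATION, up to the residual.**  Let `K₀` be an EXOTIC maximal compact subgroup of `π₁^temp(𝒢)` and `K`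
a compact subgroup with `K ⊓ K₀ ≠ 1`.  Then `K ≤ K₀`, OR there are a level `m` and a vertex `z` of `𝒢_{∞,m}`,
fixed by neither, over a base vertex of INFINITE valence, such that every level `M ≥ m` carries an unfolded
`K ⊓ K₀`-fixed branch pair over `z`.  (If `(K ⊔ K₀)‾` is compact it equals `K₀` by maximality; `K₀` anchored is
excluded.) [cite: MochizukiSemiAnbd2006, Thm 3.7(iv) p.41] -/
theorem le_or_residual_of_isMaximalCompactSubgroup_of_exotic (h37 : 𝒢.Thm37Hypotheses)
    (K K₀ : Subgroup ((𝒢.galoisLevelData h37.toProp36Hypotheses).temperedPi h37.toProp36Hypotheses.isCountable))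
    (hK : IsCompact (K : Set ((𝒢.galoisLevelData h37.toProp36Hypotheses).temperedPi
      h37.toProp36Hypotheses.isCountable)))
    (hK₀ : IsMaximalCompactSubgroup K₀)
    (hK₀ex : ∀ (w : 𝒢.graph.Vertex) (H' : Subgroup (𝒢.temperedPiChart h37.toProp36Hypotheses).G),
      H' ∈ verticialSubgroups (𝒢.temperedPiChart h37.toProp36Hypotheses) w → ¬ K₀ ≤ H')
    (hne : K ⊓ K₀ ≠ ⊥) :
    K ≤ K₀ ∨
    ∃ (m : ℕ) (z : ((𝒢.galoisLevelData h37.toProp36Hypotheses).tree m).Vertex),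
      (¬ ∀ k ∈ K, ((𝒢.galoisLevelData h37.toProp36Hypotheses).treeAct h37.toProp36Hypotheses.isCountable m
          k).hom.vertexMap z = z) ∧
      (¬ ∀ k ∈ K₀, ((𝒢.galoisLevelData h37.toProp36Hypotheses).treeAct h37.toProp36Hypotheses.isCountable m
          k).hom.vertexMap z = z) ∧
      ¬ {b : 𝒢.graph.Branch | 𝒢.graph.abuts b =
          some (((𝒢.galoisLevelData h37.toProp36Hypotheses).treeProj m).vertexMap z)}.Finite ∧
      ∀ (M : ℕ) (hmM : m ≤ M),
        ∃ (w : ((𝒢.galoisLevelData h37.toProp36Hypotheses).tree M).Vertex)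
          (β β' : ((𝒢.galoisLevelData h37.toProp36Hypotheses).tree M).Branch),
          ((𝒢.galoisLevelData h37.toProp36Hypotheses).tree M).abuts β = some w ∧
          ((𝒢.galoisLevelData h37.toProp36Hypotheses).tree M).abuts β' = some w ∧
          ((𝒢.galoisLevelData h37.toProp36Hypotheses).treeTrans hmM).vertexMap w = z ∧
          ((𝒢.galoisLevelData h37.toProp36Hypotheses).treeTrans hmM).branchMap β ≠
            ((𝒢.galoisLevelData h37.toProp36Hypotheses).treeTrans hmM).branchMap β' ∧
          ∀ d ∈ K ⊓ K₀,
            ((𝒢.galoisLevelData h37.toProp36Hypotheses).treeAct h37.toProp36Hypotheses.isCountable M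
                d).hom.vertexMap w = w ∧
            ((𝒢.galoisLevelData h37.toProp36Hypotheses).treeAct h37.toProp36Hypotheses.isCountable M
                d).hom.branchMap β = β ∧
            ((𝒢.galoisLevelData h37.toProp36Hypotheses).treeAct h37.toProp36Hypotheses.isCountable M
                d).hom.branchMap β' = β' := by
  classical
  have h36 := h37.toProp36Hypotheses
  by_cases hle : K ≤ K₀
  · exact Or.inl hle
  · right
    -- `(K ⊔ K₀)‾` is not compact: it would equal the maximal compact `K₀`, forcing `K ≤ K₀`
    have hnot : ¬ IsCompact (((K ⊔ K₀).topologicalClosure :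
        Subgroup ((𝒢.galoisLevelData h36).temperedPi h36.isCountable)) :
          Set ((𝒢.galoisLevelData h36).temperedPi h36.isCountable)) := by
      intro hcpt
      have hle₀ : K₀ ≤ (K ⊔ K₀).topologicalClosure := le_sup_right.trans (Subgroup.le_topologicalClosure _)
      have heq := hK₀.2 _ hcpt hle₀
      exact hle ((le_sup_left.trans (Subgroup.le_topologicalClosure _)).trans heq.le)
    rcases anchored_or_infinite_valence_of_not_isCompact h37 K K₀ hK hK₀.1 hne hnot with
      ⟨-, ⟨w, H', hH', hK₀H'⟩, -⟩ | hres
    · exact absurd hK₀H' (hK₀ex w H' hH')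
    · exact hres

/-! ### Sentence 2 reduces to the residual -/

/-- ★ **THM 3.7 (iv), SECOND SENTENCE, up to the residual.**  Let `K₁ ≠ K₂` be maximal compact subgroups of
`π₁^temp(𝒢)` with `K₁ ⊓ K₂ ≠ 1`.  Then BOTH are VERTICIAL and `K₁ ⊓ K₂` lies in an edge-like subgroup, OR there
are a level `m` and a vertex `z` of `𝒢_{∞,m}`, fixed by neither, over a base vertex of INFINITE valence, such
that every level `M ≥ m` carries an unfolded `K₁ ⊓ K₂`-fixed branch pair over `z`.  (Two distinct maximal
compact subgroups never generate a compact subgroup; in the anchored regime maximality makes `Kᵢ` EQUAL to the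
verticial subgroup containing it.) [cite: MochizukiSemiAnbd2006, Thm 3.7(iv) p.41] -/
theorem verticial_or_residual_of_isMaximalCompactSubgroup_of_ne (h37 : 𝒢.Thm37Hypotheses)
    (K₁ K₂ : Subgroup ((𝒢.galoisLevelData h37.toProp36Hypotheses).temperedPi h37.toProp36Hypotheses.isCountable))
    (hK₁ : IsMaximalCompactSubgroup K₁) (hK₂ : IsMaximalCompactSubgroup K₂) (hne₁₂ : K₁ ≠ K₂)
    (hne : K₁ ⊓ K₂ ≠ ⊥) :
    ((∃ v : 𝒢.graph.Vertex, K₁ ∈ verticialSubgroups (𝒢.temperedPiChart h37.toProp36Hypotheses) v) ∧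
      (∃ v : 𝒢.graph.Vertex, K₂ ∈ verticialSubgroups (𝒢.temperedPiChart h37.toProp36Hypotheses) v) ∧
      ∃ (e : 𝒢.graph.Edge) (L : Subgroup (𝒢.temperedPiChart h37.toProp36Hypotheses).G),
        L ∈ edgeLikeSubgroups (𝒢.temperedPiChart h37.toProp36Hypotheses) e ∧ K₁ ⊓ K₂ ≤ L) ∨
    ∃ (m : ℕ) (z : ((𝒢.galoisLevelData h37.toProp36Hypotheses).tree m).Vertex),
      (¬ ∀ k ∈ K₁, ((𝒢.galoisLevelData h37.toProp36Hypotheses).treeAct h37.toProp36Hypotheses.isCountable m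
          k).hom.vertexMap z = z) ∧
      (¬ ∀ k ∈ K₂, ((𝒢.galoisLevelData h37.toProp36Hypotheses).treeAct h37.toProp36Hypotheses.isCountable m
          k).hom.vertexMap z = z) ∧
      ¬ {b : 𝒢.graph.Branch | 𝒢.graph.abuts b =
          some (((𝒢.galoisLevelData h37.toProp36Hypotheses).treeProj m).vertexMap z)}.Finite ∧
      ∀ (M : ℕ) (hmM : m ≤ M),
        ∃ (w : ((𝒢.galoisLevelData h37.toProp36Hypotheses).tree M).Vertex)
          (β β' : ((𝒢.galoisLevelData h37.toProp36Hypotheses).tree M).Branch),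
          ((𝒢.galoisLevelData h37.toProp36Hypotheses).tree M).abuts β = some w ∧
          ((𝒢.galoisLevelData h37.toProp36Hypotheses).tree M).abuts β' = some w ∧
          ((𝒢.galoisLevelData h37.toProp36Hypotheses).treeTrans hmM).vertexMap w = z ∧
          ((𝒢.galoisLevelData h37.toProp36Hypotheses).treeTrans hmM).branchMap β ≠
            ((𝒢.galoisLevelData h37.toProp36Hypotheses).treeTrans hmM).branchMap β' ∧
          ∀ d ∈ K₁ ⊓ K₂,
            ((𝒢.galoisLevelData h37.toProp36Hypotheses).treeAct h37.toProp36Hypotheses.isCountable M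
                d).hom.vertexMap w = w ∧
            ((𝒢.galoisLevelData h37.toProp36Hypotheses).treeAct h37.toProp36Hypotheses.isCountable M
                d).hom.branchMap β = β ∧
            ((𝒢.galoisLevelData h37.toProp36Hypotheses).treeAct h37.toProp36Hypotheses.isCountable M
                d).hom.branchMap β' = β' := by
  classical
  have h36 := h37.toProp36Hypotheses
  -- two distinct maximal compact subgroups do not generate a compact subgroup
  have hnot : ¬ IsCompact (((K₁ ⊔ K₂).topologicalClosure :
      Subgroup ((𝒢.galoisLevelData h36).temperedPi h36.isCountable)) :
        Set ((𝒢.galoisLevelData h36).temperedPi h36.isCountable)) := by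
    intro hcpt
    have h₁ := hK₁.2 _ hcpt (le_sup_left.trans (Subgroup.le_topologicalClosure _))
    have h₂ := hK₂.2 _ hcpt (le_sup_right.trans (Subgroup.le_topologicalClosure _))
    exact hne₁₂ (h₁.symm.trans h₂)
  rcases anchored_or_infinite_valence_of_not_isCompact h37 K₁ K₂ hK₁.1 hK₂.1 hne hnot with
    ⟨⟨v₁, H₁, hH₁, hK₁H₁⟩, ⟨v₂, H₂, hH₂, hK₂H₂⟩, hedge⟩ | hres
  · left
    have h₁ : K₁ = H₁ :=
      le_antisymm hK₁H₁ ((hK₁.2 H₁ (isCompact_of_mem_verticialSubgroups _ hH₁) hK₁H₁).le)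
    have h₂ : K₂ = H₂ :=
      le_antisymm hK₂H₂ ((hK₂.2 H₂ (isCompact_of_mem_verticialSubgroups _ hH₂) hK₂H₂).le)
    exact ⟨⟨v₁, h₁ ▸ hH₁⟩, ⟨v₂, h₂ ▸ hH₂⟩, hedge⟩
  · exact Or.inr hres

end ProfiniteSemiGraph

end Literature.AnabelianGeometry.SemiGraphs

end
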